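import Mathlib.Data.Fin.Tuple.Sort
import Literature.NumberTheory.Transcendental.KZSemiCanonicalReductionProofs
import Literature.MeasureTheory.Lebesgue.PolynomialZeroSet

/-!
# Crux `VolumeFormOffPlane` (stmt-KontsevichZagierPeriods-14935) — line `Sketch`,
stub `stub_cubeDecomposition` (the cube is the sum of its order cells)

Box-dimension `n` (total dimension `n + 1`): box coordinates `x_ι = p (Fin.castSucc ι)` and slack
`z = p (Fin.last n)` subject to `0 < z ∧ z · ∏ x_ι < 1`. For `g : ℝ` the CUBE is
`C(g) = {1 < x_ι < g} ∩ {slack}` and, for a permutation `σ` of `Fin n`, the ORDER CELL is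
`O_σ(g) = {StrictMono (ι ↦ x_{σ ι})} ∩ C(g)`. For integrand-`1` representations `r` on `C(g)` and
`R σ` on `O_σ(g)` we show `[r] − ∑_σ [R σ] ∈ KZ.relations`: this is rule (1a) iterated over the
finite almost-partition of the cube by its `n!` order cells
(`KZ.of_sub_sum_of_mem_relations` over `Finset.univ`), whose four hypotheses are

* `O_σ(g) ⊆ C(g)` (so `O_σ(g) ∖ C(g) = ∅` is null);
* the integrands agree on `O_σ(g) ∩ C(g)` (both are `1` there);
* coverage up to a null set: if the box coordinates of `p ∈ C(g)` are pairwise distinct, i.e. the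
  tuple `x = (x_ι)` is injective, then `σ := Tuple.sort x` makes `x ∘ σ` monotone
  (`Tuple.monotone_sort`) and injective, hence strictly monotone, so `p ∈ O_σ(g)`; therefore
  `C(g) ∖ ⋃_σ O_σ(g)` lies in the finite union of the walls `{x_ι = x_κ}` (`ι ≠ κ`), each the zero
  set of the nonzero polynomial `X_{castSucc ι} − X_{castSucc κ}`, hence Lebesgue-null
  (`MvPolynomial.volume_zeroSet_eq_zero`);
* the cells are pairwise disjoint: a strictly monotone rearrangement `x ∘ σ` forces
  `σ = Tuple.sort x` (`Tuple.eq_sort_iff`, the tie-breaking condition being vacuous), so two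
  cells `O_σ(g)`, `O_τ(g)` with `σ ≠ τ` do not meet.

Sources: M. Kontsevich, D. Zagier, *Periods* (2001), §1.2 rule (1). Folklore bookkeeping.
-/

noncomputable section

open MeasureTheory Set MvPolynomial
open Literature.NumberTheory.Transcendental

namespace Summit.KontsevichZagierPeriods.SymplecticScissors.LogPolytope

/-! ## Sorting a tuple: existence and uniqueness of the increasing rearrangement -/

/-- A strictly increasing rearrangement `i ↦ f (σ i)` of a tuple `f` pins down the permutation:
`σ = Tuple.sort f` (the tie-breaking clause of `Tuple.eq_sort_iff` is vacuous). [folklore] -/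
theorem cdc_eq_sort_of_strictMono {n : ℕ} {α : Type*} [LinearOrder α] (f : Fin n → α)
    (σ : Equiv.Perm (Fin n)) (hσ : StrictMono (fun i => f (σ i))) : σ = Tuple.sort f :=
  Tuple.eq_sort_iff.mpr ⟨hσ.monotone, fun _ _ hij h => absurd h (hσ hij).ne⟩

/-- Two permutations along which the same tuple is strictly increasing are equal. [folklore] -/
theorem cdc_perm_eq_of_strictMono {n : ℕ} {α : Type*} [LinearOrder α] (f : Fin n → α)
    (σ τ : Equiv.Perm (Fin n)) (hσ : StrictMono (fun i => f (σ i)))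
    (hτ : StrictMono (fun i => f (τ i))) : σ = τ :=
  (cdc_eq_sort_of_strictMono f σ hσ).trans (cdc_eq_sort_of_strictMono f τ hτ).symm

/-- An injective tuple has a strictly increasing rearrangement, namely along `Tuple.sort`.
[folklore] -/
theorem cdc_exists_strictMono {n : ℕ} {α : Type*} [LinearOrder α] (f : Fin n → α)
    (hf : Function.Injective f) : ∃ σ : Equiv.Perm (Fin n), StrictMono (fun i => f (σ i)) :=
  ⟨Tuple.sort f,
    (Tuple.monotone_sort f).strictMono_of_injective (hf.comp (Tuple.sort f).injective)⟩

/-! ## The diagonal walls are null -/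

/-- For distinct box indices `ι ≠ κ` the wall `{p | p (castSucc ι) = p (castSucc κ)}` in `ℝⁿ⁺¹` is
Lebesgue-null: it is the zero set of the nonzero polynomial `X_{castSucc ι} − X_{castSucc κ}`.
[folklore] -/
theorem cdc_volume_wall_eq_zero {n : ℕ} {ι κ : Fin n} (h : ι ≠ κ) :
    volume {p : Fin (n + 1) → ℝ | p (Fin.castSucc ι) = p (Fin.castSucc κ)} = 0 := by
  have hne : (X (Fin.castSucc ι) - X (Fin.castSucc κ) : MvPolynomial (Fin (n + 1)) ℝ) ≠ 0 :=
    sub_ne_zero.mpr fun h' => h (Fin.castSucc_injective n (X_injective h'))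
  have := MvPolynomial.volume_zeroSet_eq_zero (n + 1) _ hne
  simpa [sub_eq_zero] using this

/-- The union of the diagonal walls `{x_ι = x_κ}` (`ι ≠ κ`) of the box coordinates is Lebesgue-null
(a finite union of null hyperplanes). [folklore] -/
theorem cdc_volume_walls_eq_zero (n : ℕ) :
    volume {p : Fin (n + 1) → ℝ | ∃ ι κ : Fin n, ι ≠ κ ∧ p (Fin.castSucc ι) = p (Fin.castSucc κ)}
      = 0 := by
  have hU : {p : Fin (n + 1) → ℝ | ∃ ι κ : Fin n, ι ≠ κ ∧ p (Fin.castSucc ι) = p (Fin.castSucc κ)}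
      = ⋃ ι : Fin n, ⋃ κ : Fin n, {p | ι ≠ κ ∧ p (Fin.castSucc ι) = p (Fin.castSucc κ)} := by
    ext p
    simp only [mem_setOf_eq, mem_iUnion]
  rw [hU]
  refine measure_iUnion_null fun ι => measure_iUnion_null fun κ => ?_
  by_cases h : ι = κ
  · simp [h]
  · simp only [ne_eq, h, not_false_eq_true, true_and]
    exact cdc_volume_wall_eq_zero h

/-! ## The stub -/

/-- **Stub (the cube is the sum of its order cells).** Rule (1a) iterated over the finite
almost-partition of the cube `{1 < x_ι < g}` by the `n!` order cells (`KZ.of_sub_sum_of_mem_relations`):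
the cells are pairwise disjoint (an injective tuple has a unique increasing rearrangement,
`Tuple.eq_sort_iff`), and they cover the cube up to the null walls `{x_ι = x_κ}`
(`Tuple.sort` sorts a tuple with distinct entries; `MvPolynomial.volume_zeroSet_eq_zero`).
[folklore] -/
theorem stub_cubeDecomposition : (∀ (n : ℕ) (g : ℝ) (r : KZ.IntegralRep (n + 1)) (R : Equiv.Perm (Fin n) → KZ.IntegralRep (n + 1)), r.domain = {p : Fin ((n) + 1) → ℝ | (∀ ι : Fin (n), 1 < p (Fin.castSucc ι) ∧ p (Fin.castSucc ι) < g) ∧ 0 < p (Fin.last (n)) ∧ p (Fin.last (n)) * ∏ ι : Fin (n), p (Fin.castSucc ι) < 1} → (∀ σ, (R σ).domain = {p : Fin ((n) + 1) → ℝ | StrictMono (fun ι : Fin (n) => p (Fin.castSucc (σ ι))) ∧ (∀ ι : Fin (n), 1 < p (Fin.castSucc ι) ∧ p (Fin.castSucc ι) < g) ∧ 0 < p (Fin.last (n)) ∧ p (Fin.last (n)) * ∏ ι : Fin (n), p (Fin.castSucc ι) < 1}) → (∀ p ∈ r.domain, r.integrand p = 1) → (∀ σ, ∀ p ∈ (R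 σ).domain, (R σ).integrand p = 1) → KZ.of r - ∑ σ, KZ.of (R σ) ∈ KZ.relations) := by
  intro n g r R hr hR hri hRi
  refine KZ.of_sub_sum_of_mem_relations Finset.univ r R (fun σ _ => ?_) (fun σ _ p hp => ?_) ?_
    (fun σ _ τ _ hστ => ?_)
  · -- (i) every order cell lies in the cube
    rw [show (R σ).domain \ r.domain = ∅ from ?_, measure_empty]
    rw [hR σ, hr]
    exact sdiff_eq_empty.mpr fun p hp => hp.2
  · -- (ii) the integrands agree (both are `1`)
    rw [hRi σ p hp.1, hri p hp.2]
  · -- (iii) the cells cover the cube off the null diagonal walls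
    refine measure_mono_null (fun p hp => ?_) (cdc_volume_walls_eq_zero n)
    obtain ⟨hpr, hpU⟩ := hp
    rw [mem_setOf_eq]
    by_contra hW
    have hinj : Function.Injective (fun ι : Fin n => p (Fin.castSucc ι)) :=
      fun ι κ hικ => by_contra fun hne => hW ⟨ι, κ, hne, hικ⟩
    obtain ⟨σ, hσ⟩ := cdc_exists_strictMono _ hinj
    refine hpU (mem_iUnion₂.mpr ⟨σ, Finset.mem_univ σ, ?_⟩)
    rw [hR σ]
    rw [hr] at hpr
    exact ⟨hσ, hpr⟩
  · -- (iv) distinct cells are disjoint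
    show volume ((R σ).domain ∩ (R τ).domain) = 0
    rw [show (R σ).domain ∩ (R τ).domain = ∅ from ?_, measure_empty]
    rw [hR σ, hR τ]
    exact eq_empty_of_forall_notMem fun p hp =>
      hστ (cdc_perm_eq_of_strictMono (fun ι : Fin n => p (Fin.castSucc ι)) σ τ hp.1.1 hp.2.1)

end Summit.KontsevichZagierPeriods.SymplecticScissors.LogPolytope

end
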